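import Summits.NavierStokesRegularity.FunctionalMining.NoGo.LogDoorBackgroundField
import Summits.NavierStokesRegularity.FunctionalMining.NoGo.LogDoorOscillation
import Summits.NavierStokesRegularity.FunctionalMining.QuadraticBudgetPlanting
import Summits.NavierStokesRegularity.FunctionalMining.Candidates
import HarnessLib

/-!
# The log-door witness: Euclidean vorticity, its planting on `T³`, and the entry bounds

Search for candidate a priori estimates; no regularity claim. NS FUNCTIONAL MINING — NO-GO BRANCH
(cell `pub-nsfunc`, prove seat gen 3). Vorticity bookkeeping for the no-go N6:
* `eVortSq g y = ½ Σᵢⱼ ((∂ᵢg)ⱼ − (∂ⱼg)ᵢ)²` on `ℝ³` (the Euclidean twin of `torusVorticitySqAt`),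
  `= e₀₁² + e₀₂² + e₁₂²` (`eVortSq_eq_three`);
* planting: `torusVorticitySqAt (periodize g) x = eVortSq g (repr x)` for `g` supported in the open
  unit cube, and `eVortSq (c U(c(·+a))) = c⁴ eVortSq U ∘ …` (`torusVorticitySqAt_periodize`,
  `eVortSq_plant`);
* the three vorticity entries of the background `G_n` (bounded UNIFORMLY in `n`,
  `abs_background_entries_le`) and of the packet `W_K` (`packet_entries`, with the `K`-explicit
  bounds `|g_K| ≤ Φ₀/K²`, `|g_K'| ≤ (Φ₀+Φ₁)/K`, `|g_K''| ≤ Φ₀ + (2Φ₁+Φ₂)/K`).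
Folklore calculus; nothing is asserted about Navier–Stokes.
-/

open MeasureTheory Set Function Filter Real
open scoped ContDiff Topology

namespace Summit.NavierStokesRegularity.FunctionalMining

namespace Sep3

open Literature.Analysis.FunctionSpaces Literature.Analysis.FluidPDE

/-- `∞ ≠ 0` in `WithTop ℕ∞`. [folklore] -/
private theorem infty_ne_zero₆ : (∞ : WithTop ℕ∞) ≠ 0 := by simp

/-! ## Euclidean vorticity squared -/

/-- The Euclidean squared vorticity `½ Σᵢⱼ ((∂ᵢg)ⱼ − (∂ⱼg)ᵢ)²` of a field on `ℝ³` at `y` (the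
whole-space twin of `torusVorticitySqAt`). [folklore] -/
noncomputable def eVortSq (g : E3 → E3) (y : E3) : ℝ :=
  2⁻¹ * ∑ i, ∑ j, ((fderiv ℝ g y (EuclideanSpace.single i 1)) j -
    (fderiv ℝ g y (EuclideanSpace.single j 1)) i) ^ 2

/-- The entry `(∂ᵢg)ⱼ − (∂ⱼg)ᵢ` of the antisymmetric part of `Dg(y)`. [folklore] -/
noncomputable def vortEntry (g : E3 → E3) (y : E3) (i j : Fin 3) : ℝ :=
  (fderiv ℝ g y (EuclideanSpace.single i 1)) j - (fderiv ℝ g y (EuclideanSpace.single j 1)) i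

/-- `eVortSq = e₀₁² + e₀₂² + e₁₂²`. [folklore] -/
theorem eVortSq_eq_three (g : E3 → E3) (y : E3) :
    eVortSq g y = vortEntry g y 0 1 ^ 2 + vortEntry g y 0 2 ^ 2 + vortEntry g y 1 2 ^ 2 := by
  simp only [eVortSq, vortEntry, Fin.sum_univ_three]
  ring

/-- `0 ≤ eVortSq`. [folklore] -/
theorem eVortSq_nonneg (g : E3 → E3) (y : E3) : 0 ≤ eVortSq g y := by
  rw [eVortSq_eq_three]; positivity

/-- Entries of a sum of differentiable fields add. [folklore] -/
theorem vortEntry_add {g₁ g₂ : E3 → E3} {y : E3} (h₁ : DifferentiableAt ℝ g₁ y)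
    (h₂ : DifferentiableAt ℝ g₂ y) (i j : Fin 3) :
    vortEntry (fun z => g₁ z + g₂ z) y i j = vortEntry g₁ y i j + vortEntry g₂ y i j := by
  simp only [vortEntry, fderiv_fun_add h₁ h₂, add_apply, PiLp.add_apply]
  ring

/-- Entries of a difference of differentiable fields subtract. [folklore] -/
theorem vortEntry_sub {g₁ g₂ : E3 → E3} {y : E3} (h₁ : DifferentiableAt ℝ g₁ y)
    (h₂ : DifferentiableAt ℝ g₂ y) (i j : Fin 3) :
    vortEntry (fun z => g₁ z - g₂ z) y i j = vortEntry g₁ y i j - vortEntry g₂ y i j := by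
  simp only [vortEntry, fderiv_fun_sub h₁ h₂, sub_apply, PiLp.sub_apply]
  ring

/-- If the entries of `g₁` are bounded by `α` and those of `g₂` by `β`, then
`eVortSq (g₁ ± g₂) ≤ (α₀₁+β₀₁)² + (α₀₂+β₀₂)² + (α₁₂+β₁₂)²`. [folklore] -/
theorem eVortSq_add_sub_le {g₁ g₂ : E3 → E3} {y : E3} (h₁ : DifferentiableAt ℝ g₁ y)
    (h₂ : DifferentiableAt ℝ g₂ y) {α₀₁ α₀₂ α₁₂ β₀₁ β₀₂ β₁₂ : ℝ}
    (a01 : |vortEntry g₁ y 0 1| ≤ α₀₁) (a02 : |vortEntry g₁ y 0 2| ≤ α₀₂) (a12 : |vortEntry g₁ y 1 2| ≤ α₁₂)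
    (b01 : |vortEntry g₂ y 0 1| ≤ β₀₁) (b02 : |vortEntry g₂ y 0 2| ≤ β₀₂) (b12 : |vortEntry g₂ y 1 2| ≤ β₁₂) :
    eVortSq (fun z => g₁ z + g₂ z) y ≤ (α₀₁ + β₀₁) ^ 2 + (α₀₂ + β₀₂) ^ 2 + (α₁₂ + β₁₂) ^ 2 ∧
      eVortSq (fun z => g₁ z - g₂ z) y ≤ (α₀₁ + β₀₁) ^ 2 + (α₀₂ + β₀₂) ^ 2 + (α₁₂ + β₁₂) ^ 2 := by
  have key : ∀ {a b α β : ℝ}, |a| ≤ α → |b| ≤ β →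
      (a + b) ^ 2 ≤ (α + β) ^ 2 ∧ (a - b) ^ 2 ≤ (α + β) ^ 2 := by
    intro a b α β ha hb
    have h1 : |a + b| ≤ α + β := (abs_add_le _ _).trans (add_le_add ha hb)
    have h2 : |a - b| ≤ α + β := (abs_sub _ _).trans (add_le_add ha hb)
    exact ⟨by rw [← sq_abs (a + b)]; exact pow_le_pow_left₀ (abs_nonneg _) h1 2,
      by rw [← sq_abs (a - b)]; exact pow_le_pow_left₀ (abs_nonneg _) h2 2⟩
  constructor
  · rw [eVortSq_eq_three, vortEntry_add h₁ h₂, vortEntry_add h₁ h₂, vortEntry_add h₁ h₂]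
    linarith [(key a01 b01).1, (key a02 b02).1, (key a12 b12).1]
  · rw [eVortSq_eq_three, vortEntry_sub h₁ h₂, vortEntry_sub h₁ h₂, vortEntry_sub h₁ h₂]
    linarith [(key a01 b01).2, (key a02 b02).2, (key a12 b12).2]

/-! ## Planting the vorticity -/

/-- **Periodisation transfers the vorticity pointwise**: for `g` smooth and supported in the open
unit cube, `torusVorticitySqAt (periodize g) x = eVortSq g (repr x)`. [folklore] -/
theorem torusVorticitySqAt_periodize {g : E3 → E3} (hg : ContDiff ℝ ∞ g)
    (hgs : tsupport g ⊆ {y | ∀ i, y i ∈ Ioo (0 : ℝ) 1}) (x : UnitAddTorus (Fin 3)) :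
    torusVorticitySqAt (Torus.periodize g) x = eVortSq g (Torus.repr x) := by
  obtain ⟨-, h1, -⟩ := eq_zero_off_cube hgs
  have hR := Torus.tsupport_subset_closedBall_of_openCube hgs
  have hsm : Torus.IsContDiff 1 (Torus.periodize g) :=
    (Torus.isSmooth_periodize hg hR).isContDiff (WithTop.coe_le_coe.mpr le_top)
  have hD : ∀ i, Torus.partialDeriv i (Torus.periodize g) x = fderiv ℝ g (Torus.repr x)
      (EuclideanSpace.single i 1) := by
    intro i
    rw [Torus.partialDeriv_eq_fderiv_apply hsm,
      Torus.fderiv_periodize' (hg.of_le (by exact_mod_cast le_top)) hR,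
      Torus.perSum_eq_self_of_mem_unitCube h1 (Torus.repr_mem_unitCube x)]
  simp only [torusVorticitySqAt, eVortSq, hD]

/-- **Concentration scales the vorticity by `c²`:** `eVortSq (c U(c(·+a))) (y) = c⁴ eVortSq U (c(y+a))`.
[folklore] -/
theorem eVortSq_plant (U : E3 → E3) {c : ℝ} (hc : c ≠ 0) (a y : E3) :
    eVortSq (fun y => c • U (c • (y + a))) y = c ^ 4 * eVortSq U (c • (y + a)) := by
  simp only [eVortSq, fderiv_plant U hc a y, smul_apply, PiLp.smul_apply,
    smul_eq_mul, Finset.mul_sum]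
  refine Finset.sum_congr rfl fun i _ => Finset.sum_congr rfl fun j _ => ?_
  ring

/-! ## Entries of `vec3` fields -/

/-- Entries of a `vec3` field in terms of its components. [folklore] -/
theorem vortEntry_vec3 {U : Fin 3 → E3 → ℝ} (hU : ∀ i, Differentiable ℝ (U i)) (y : E3) (i j : Fin 3) :
    vortEntry (vec3 U) y i j =
      fderiv ℝ (U j) y (EuclideanSpace.single i 1) - fderiv ℝ (U i) y (EuclideanSpace.single j 1) := by
  simp only [vortEntry, fderiv_vec3_apply hU]

/-! ## The background's entries: bounded uniformly in `n` -/

/-- **Vorticity entries of the background `G_n`**, bounded uniformly in `n`: with `B₁, B₂` bounds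
for `|β'|, |β''|` and `E₀, E₁` bounds for `|η|, |η'|`:
`|e₀₁| ≤ (24B₁ + 32B₂)E₀`, `|e₀₂| ≤ (2 + 8B₁)E₁`, `|e₁₂| ≤ (2 + 8B₁)E₁`. [folklore] -/
theorem abs_background_entries_le {n : ℕ} {η : ℝ → ℝ} (hη : ContDiff ℝ ∞ η) {B₁ B₂ E₀ E₁ : ℝ}
    (hB₁ : 0 ≤ B₁) (hB₂ : 0 ≤ B₂) (hb1 : ∀ s, |iteratedDeriv 1 stepB s| ≤ B₁)
    (hb2 : ∀ s, |iteratedDeriv 2 stepB s| ≤ B₂) (hE0 : ∀ t, |η t| ≤ E₀) (hE1 : ∀ t, |deriv η t| ≤ E₁)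
    (y : E3) :
    |vortEntry (background n η) y 0 1| ≤ (24 * B₁ + 32 * B₂) * E₀ ∧
      |vortEntry (background n η) y 0 2| ≤ (2 + 8 * B₁) * E₁ ∧
      |vortEntry (background n η) y 1 2| ≤ (2 + 8 * B₁) * E₁ := by
  have hE0' : 0 ≤ E₀ := (abs_nonneg _).trans (hE0 0)
  have hE1' : 0 ≤ E₁ := (abs_nonneg _).trans (hE1 0)
  rw [background, vortEntry_vec3 (differentiable_UG hη), vortEntry_vec3 (differentiable_UG hη),
    vortEntry_vec3 (differentiable_UG hη), background_curl01 hη, background_curl02 hη,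
    background_curl12 hη]
  obtain ⟨s0, s1⟩ := abs_streamGrad_le n hB₁ hb1 y
  have p := abs_planarVorticity_le n hB₁ hB₂ hb1 hb2 y
  refine ⟨?_, ?_, ?_⟩
  · rw [abs_neg, abs_mul]
    calc |η (y 2)| * |y 0 * y 1 * (12 * deriv (coreH n) (Qr y) + 4 * Qr y * deriv (deriv (coreH n)) (Qr y))|
        ≤ E₀ * (24 * B₁ + 32 * B₂) := mul_le_mul (hE0 _) p (abs_nonneg _) hE0'
      _ = (24 * B₁ + 32 * B₂) * E₀ := by ring
  · rw [abs_neg, abs_mul]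
    exact mul_le_mul s0 (hE1 _) (abs_nonneg _) (by positivity)
  · rw [abs_mul]
    exact mul_le_mul s1 (hE1 _) (abs_nonneg _) (by positivity)

/-! ## The packet's entries -/

/-- **Vorticity entries of the packet**: `e₀₁ = −(a''gη + a g''η)`, `e₀₂ = −a g'η'`, `e₁₂ = a'gη'`
(in separable monomials). [folklore] -/
theorem packet_entries {φ : Fin 3 → ℝ → ℝ} (hφ : ∀ a, ContDiff ℝ ∞ (φ a)) (y : E3) :
    vortEntry (packet φ) y 0 1 = -(sep φ 2 0 0 y + sep φ 0 2 0 y) ∧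
      vortEntry (packet φ) y 0 2 = -sep φ 0 1 1 y ∧
      vortEntry (packet φ) y 1 2 = sep φ 1 0 1 y := by
  rw [packet, vortEntry_vec3 (differentiable_UW hφ), vortEntry_vec3 (differentiable_UW hφ),
    vortEntry_vec3 (differentiable_UW hφ), fderiv_UW_zero hφ, fderiv_UW_zero hφ, fderiv_UW_one hφ,
    fderiv_UW_one hφ, fderiv_UW_two, fderiv_UW_two]
  simp only [PiLp.single_apply]
  simp
  ring

/-- `K`-explicit bounds for the oscillatory profile (`K ≥ 1`): `|g_K| ≤ Φ₀/K²`,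
`|g_K'| ≤ (Φ₁+Φ₀)/K`, `|g_K''| ≤ Φ₀ + (2Φ₁+Φ₂)/K`. [folklore] -/
theorem abs_gK_bounds {ψ : ℝ → ℝ} (hψ : ContDiff ℝ ∞ ψ) {K : ℝ} (hK : 1 ≤ K) {Φ₀ Φ₁ Φ₂ : ℝ}
    (hΦ₀ : ∀ t, |iteratedDeriv 0 ψ t| ≤ Φ₀) (hΦ₁ : ∀ t, |iteratedDeriv 1 ψ t| ≤ Φ₁)
    (hΦ₂ : ∀ t, |iteratedDeriv 2 ψ t| ≤ Φ₂) (t : ℝ) :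
    |iteratedDeriv 0 (gK ψ K) t| ≤ Φ₀ / K ^ 2 ∧ |iteratedDeriv 1 (gK ψ K) t| ≤ (Φ₁ + Φ₀) / K ∧
      |iteratedDeriv 2 (gK ψ K) t| ≤ Φ₀ + (2 * Φ₁ + Φ₂) / K := by
  have hK0 : 0 < K := by linarith
  have hK2 : 0 < K ^ 2 := by positivity
  have hKK : K ≤ K ^ 2 := by nlinarith
  have hΦ₀' : 0 ≤ Φ₀ := (abs_nonneg _).trans (hΦ₀ 0)
  have hΦ₁' : 0 ≤ Φ₁ := (abs_nonneg _).trans (hΦ₁ 0)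
  have hΦ₂' : 0 ≤ Φ₂ := (abs_nonneg _).trans (hΦ₂ 0)
  have hinv : (K ^ 2)⁻¹ ≤ K⁻¹ := by
    rw [inv_le_inv₀ hK2 hK0]; exact hKK
  refine ⟨?_, ?_, ?_⟩
  · rw [iteratedDeriv_zero, gK_eq]
    refine (abs_cos_sin_le _ _ _ _).trans ?_
    rw [abs_zero, add_zero, abs_mul, abs_inv, abs_of_pos hK2, div_eq_mul_inv, mul_comm Φ₀]
    exact mul_le_mul_of_nonneg_left (hΦ₀ t) (by positivity)
  · rw [iteratedDeriv_gK_one hψ]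
    refine (abs_cos_sin_le _ _ _ _).trans ?_
    rw [abs_neg, abs_mul, abs_mul, abs_mul, abs_inv, abs_of_pos hK2, abs_of_pos hK0]
    have e : (K ^ 2)⁻¹ * K = K⁻¹ := by field_simp
    have h1 : (K ^ 2)⁻¹ * |iteratedDeriv 1 ψ t| ≤ K⁻¹ * Φ₁ :=
      mul_le_mul hinv (hΦ₁ t) (abs_nonneg _) (by positivity)
    have h2 : (K ^ 2)⁻¹ * K * |iteratedDeriv 0 ψ t| ≤ K⁻¹ * Φ₀ := by
      rw [e]; exact mul_le_mul_of_nonneg_left (hΦ₀ t) (by positivity)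
    rw [div_eq_mul_inv, mul_comm (Φ₁ + Φ₀)]
    linarith
  · rw [iteratedDeriv_gK_two hψ]
    refine (abs_cos_sin_le _ _ _ _).trans ?_
    have e1 : (K ^ 2)⁻¹ * (iteratedDeriv 2 ψ t - K ^ 2 * iteratedDeriv 0 ψ t) =
        (K ^ 2)⁻¹ * iteratedDeriv 2 ψ t - iteratedDeriv 0 ψ t := by field_simp
    have e2 : 2 * (K ^ 2)⁻¹ * K * iteratedDeriv 1 ψ t = 2 * (K⁻¹ * iteratedDeriv 1 ψ t) := by
      field_simp
    rw [e1, e2, abs_neg, abs_mul, abs_two, abs_mul, abs_inv, abs_of_pos hK0]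
    have h1 : |(K ^ 2)⁻¹ * iteratedDeriv 2 ψ t - iteratedDeriv 0 ψ t| ≤ K⁻¹ * Φ₂ + Φ₀ := by
      refine (abs_sub _ _).trans (add_le_add ?_ (hΦ₀ t))
      rw [abs_mul, abs_inv, abs_of_pos hK2]
      exact mul_le_mul hinv (hΦ₂ t) (abs_nonneg _) (by positivity)
    have h2 : K⁻¹ * |iteratedDeriv 1 ψ t| ≤ K⁻¹ * Φ₁ := mul_le_mul_of_nonneg_left (hΦ₁ t) (by positivity)
    have e3 : Φ₀ + (2 * Φ₁ + Φ₂) / K = (K⁻¹ * Φ₂ + Φ₀) + 2 * (K⁻¹ * Φ₁) := by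
      rw [div_eq_mul_inv]; ring
    rw [e3]
    linarith

/-- **Bounds for the packet entries** from bounds `|a⁽ⁱ⁾| ≤ Aᵢ`, `|g⁽ʲ⁾| ≤ Γⱼ`, `|η⁽ᵏ⁾| ≤ Eₖ`:
`|e₀₁| ≤ E₀(A₂Γ₀ + A₀Γ₂)`, `|e₀₂| ≤ A₀Γ₁E₁`, `|e₁₂| ≤ A₁Γ₀E₁`. [folklore] -/
theorem abs_packet_entries_le {φ : Fin 3 → ℝ → ℝ} (hφ : ∀ a, ContDiff ℝ ∞ (φ a))
    {A₀ A₁ A₂ Γ₀ Γ₁ Γ₂ E₀ E₁ : ℝ}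
    (hA₀ : ∀ t, |iteratedDeriv 0 (φ 0) t| ≤ A₀) (hA₁ : ∀ t, |iteratedDeriv 1 (φ 0) t| ≤ A₁)
    (hA₂ : ∀ t, |iteratedDeriv 2 (φ 0) t| ≤ A₂)
    (hΓ₀ : ∀ t, |iteratedDeriv 0 (φ 1) t| ≤ Γ₀) (hΓ₁ : ∀ t, |iteratedDeriv 1 (φ 1) t| ≤ Γ₁)
    (hΓ₂ : ∀ t, |iteratedDeriv 2 (φ 1) t| ≤ Γ₂)
    (hE₀ : ∀ t, |iteratedDeriv 0 (φ 2) t| ≤ E₀) (hE₁ : ∀ t, |iteratedDeriv 1 (φ 2) t| ≤ E₁) (y : E3) :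
    |vortEntry (packet φ) y 0 1| ≤ E₀ * (A₂ * Γ₀ + A₀ * Γ₂) ∧
      |vortEntry (packet φ) y 0 2| ≤ A₀ * Γ₁ * E₁ ∧ |vortEntry (packet φ) y 1 2| ≤ A₁ * Γ₀ * E₁ := by
  obtain ⟨e01, e02, e12⟩ := packet_entries hφ y
  have bnd : ∀ {i j k : ℕ} {P Q R : ℝ}, (∀ t, |iteratedDeriv i (φ 0) t| ≤ P) →
      (∀ t, |iteratedDeriv j (φ 1) t| ≤ Q) → (∀ t, |iteratedDeriv k (φ 2) t| ≤ R) →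
      |sep φ i j k y| ≤ P * Q * R := by
    intro i j k P Q R hP hQ hR
    have hP' : 0 ≤ P := (abs_nonneg _).trans (hP 0)
    have hQ' : 0 ≤ Q := (abs_nonneg _).trans (hQ 0)
    unfold sep
    rw [abs_mul, abs_mul]
    exact mul_le_mul (mul_le_mul (hP _) (hQ _) (abs_nonneg _) hP') (hR _) (abs_nonneg _)
      (mul_nonneg hP' hQ')
  refine ⟨?_, ?_, ?_⟩
  · rw [e01, abs_neg]
    refine (abs_add_le _ _).trans ?_
    have h1 := bnd hA₂ hΓ₀ hE₀
    have h2 := bnd hA₀ hΓ₂ hE₀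
    nlinarith
  · rw [e02, abs_neg]
    exact bnd hA₀ hΓ₁ hE₁
  · rw [e12]
    exact bnd hA₁ hΓ₀ hE₁

end Sep3

end Summit.NavierStokesRegularity.FunctionalMining
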